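import Summits.BirchSwinnertonDyer.Rank1Residual.F1Sign2.TwoSelmerCubicRayClassAtTwo
import Literature.NumberTheory.EllipticCurves.LeadingTerm
import HarnessLib

/-!
# Cell `bsd-f1-sign2` — kernel glue for `F1Sign2/TwoSelmerCubicRayClassAtTwo.lean` (file 2 of 2 of the MEMO-an v1.62 §24.9–§24.10 port)

THEOREMS ONLY (no `def`, no `sorry`, no named fact, no instance; ns `…F1Sign2.ANg21` as file 1).  Contents: -an g21's two glue theorems from
`Sketch_v59.lean` c6a2b75fa50a4645 — `rootNumberLaw_of_selmerLaw` (S38f + 2-Selmer parity `even_selmerRank_sub_torsionRank_iff` ⟹ S38h for curves with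
`#E(ℚ)[2] = 1`; VERBATIM l.482–502) and `bsd2_on_cubicRayRankLeOne_subcell` (GZK + DECIDER S38i + ANALYTIC CRUX AN-39 ⟹ `BSDp W 2` on the sub-cell
`{squarefree N, odd ∏c_p, odd #tors, E[2](ℚ) = 0, F₃ ramified at 2, analytic rank 1, rk₂ Cl_{𝔮²}(F₃) ≤ 1}`; l.574–589 with ONE deliberate change = REF1 §179
duty (1): the hypothesis is the tree's Gross–Zagier–Kolyvagin fact `rank_eq_analyticRank_of_analyticRank_le_one` (`Literature/…/LeadingTerm.lean`) instead of
the sketch's un-filed support def `RankOneOfAnalyticRankOne`, bullet 1 re-proved inline as `(hGZK W h1.le).1.trans h1` (= REF1's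
`REF1g16d.rankOneOfAnalyticRankOne_of_GZK`; the same one-liner is the tree's `…Rank1Residual.mordellWeilRank_eq_one_of_analyticRank` in
`Theorems/SmallImageMuTransferSchneiderX9RankOneHeightForm.lean`, not imported here); this IS REF1's `bsd2_on_cubicRayRankLeOne_subcell'`) — plus
REF1 §179's sorry-free certificates from
`HOME/REF1-data/b179/lean/Probe179.lean` VERBATIM (ns moved `REF1g16d` → `ANg21`): `sha_finite_of_GZK`, `one_mem_quadraticRayClassCharacters` (the trivial
character is always a member), `quadraticRayClassCharacters_top` (JUNK at the trivial modulus: the carrier collapses to `{1}` at `𝔪 = ⊤`), `sq_ne_top_of_isPrime`,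
`ne_bot_of_two_mem_sq` (the laws' modulus `Q ^ 2` is never `⊤`, and `Q ≠ ⊥`).  Typer -ty g16; std axioms checked on the combined scratch.  BSD is not proved
by this; no item closed.
-/

namespace Summit.BirchSwinnertonDyer.Rank1Residual.F1Sign2.ANg21

open Literature.NumberTheory.EllipticCurves Literature.NumberTheory.EllipticCurves.ModularForms UpperHalfPlane
open Literature.NumberTheory.EllipticCurves.Rank1Residual
open Summit.BirchSwinnertonDyer.Rank1Residual.F1Sign2 Summit.BirchSwinnertonDyer.Rank1Residual.F1Sign2.ANg17
open Summit.BirchSwinnertonDyer.Rank1Residual.F1Sign2.ANg18 Summit.BirchSwinnertonDyer.Rank1Residual.F1Sign2.ANg19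
open Summit.BirchSwinnertonDyer.Rank1Residual.F1Sign2.ANg20
open scoped Classical

section SelmerStorey
open NumberField

open scoped AddSubgroup in
/-- Glue: S38f + 2-Selmer parity (Dokchitser–Dokchitser / Monsky, the named fact
`even_selmerRank_sub_torsionRank_iff`) ⟹ S38h, for curves with `#E(ℚ)[2] = 1`. -/
theorem rootNumberLaw_of_selmerLaw (hDD : even_selmerRank_sub_torsionRank_iff)
    (hS : TwoSelmerIsCubicRayClassAtQSq) :
    ∀ (W : WeierstrassCurve ℚ) [W.IsElliptic], Nat.card ((W.toAffine.Point)[(2 : ℤ)]) = 1 →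
    Nat.Prime (W.conductorNorm ℤ) → W.Δ < 0 → NoRationalTwoTorsion W →
    ∀ (F : Type) [Field F] [NumberField F], IsCubicTwoDivisionField W F →
    ∀ Q : Ideal (𝓞 F), Q.IsPrime → (2 : 𝓞 F) ∈ Q ^ 2 →
    ∀ k : ℕ, Nat.card (quadraticRayClassCharacters F (Q ^ 2)) = 2 ^ k → W.rootNumber = (-1) ^ k := by
  intro W _ htors hN hΔ h2 F _ _ hF Q hQ hQ2 k hk
  have hsel : Nat.card (W.selmerGroup 2) = 2 ^ k := by rw [hS W hN hΔ h2 F hF Q hQ hQ2, hk]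
  have ht : Nat.card ((W.toAffine.Point)[((2 : ℕ) : ℤ)]) = 2 ^ 0 := by simpa using htors
  have hpar := hDD W 2 k 0 (by exact_mod_cast hsel) ht
  simp only [Nat.cast_zero, sub_zero, Int.even_coe_nat] at hpar
  rcases Nat.even_or_odd k with he | ho
  · rw [hpar.mp he, Even.neg_one_pow he]
  · have hne : W.rootNumber ≠ 1 := fun h1 => (Nat.not_even_iff_odd.mpr ho) (hpar.mpr h1)
    rcases WeierstrassCurve.rootNumber_eq_one_or W with h1 | h1
    · exact absurd h1 hne
    · rw [h1, Odd.neg_one_pow ho]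

end SelmerStorey

section DescentHalf
open NumberField

/-- The GZK fact also hands over `Finite Ш` on the decider's slice (so the `Finite (Ш[2^∞])` conjunct of `BSDp W 2` never needs S38i).
(REF1 §179 certificate `sha_finite_of_GZK`, verbatim.) -/
theorem sha_finite_of_GZK (hGZK : rank_eq_analyticRank_of_analyticRank_le_one)
    (W : WeierstrassCurve ℚ) [W.IsElliptic] (h1 : W.analyticRank = 1) : Finite W.sha :=
  (hGZK W (by rw [h1])).2

/-- Glue (kernel-checked): GZK-rank + DECIDER (S38i) + ANALYTIC CRUX (AN-39) ⟹ `BSD₂` on the sub-cell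
`{squarefree N, odd ∏c_p, odd #tors, E[2](ℚ)=0, F₃ ramified at 2, analytic rank 1, rk₂ Cl_{𝔮²}(F₃) ≤ 1}` of `RankOneAtTwoBigImageOddLocal`. -/
theorem bsd2_on_cubicRayRankLeOne_subcell (hGZK : rank_eq_analyticRank_of_analyticRank_le_one)
    (hD : ShaTwoPrimaryTrivialIffCubicRayRankLeOne) (hA : CubicRayRankLeOneForcesShaAnTwoAdicUnit) :
    ∀ (W : WeierstrassCurve ℚ) [W.IsElliptic] [W.IsGloballyMinimal],
    Squarefree (W.conductorNorm ℤ) → Odd W.tamagawaProduct → Odd W.torsionOrder → NoRationalTwoTorsion W →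
    ∀ (F : Type) [Field F] [NumberField F], IsCubicTwoDivisionField W F →
    ∀ Q : Ideal (𝓞 F), Q.IsPrime → (2 : 𝓞 F) ∈ Q ^ 2 →
    W.analyticRank = 1 → Nat.card (quadraticRayClassCharacters F (Q ^ 2)) ≤ 2 → BSDp W 2 := by
  intro W _ _ hN htam htor h2 F _ _ hF Q hQ hQ2 h1 hT
  have hcard : Nat.card (AddCommGroup.primaryComponent W.sha 2) = 1 := (hD W hN htam h2 F hF Q hQ hQ2 h1).mpr hT
  obtain ⟨q, hq, hv⟩ := hA W hN htam htor h2 F hF Q hQ hQ2 h1 hT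
  refine (bsdp_iff W 2).mpr ⟨?_, ?_, q, hq, ?_⟩
  · rw [((hGZK W h1.le).1.trans h1 : W.mordellWeilRank = 1), h1]
  · exact Nat.finite_of_card_ne_zero (by rw [hcard]; exact one_ne_zero)
  · rw [hv, hcard]; simp

end DescentHalf

/-! ### REF1 §179 certificates on the carrier (VERBATIM from `Probe179.lean`, ns `REF1g16d` → `ANg21`) -/
section Certificates
open NumberField

/-- SANITY (A3): the trivial character lies in `quadraticRayClassCharacters F m` for every modulus — the set is never empty,
so `Nat.card = 2^k` with `k = 0` is the floor, and `Nat.card … ≤ 2` in S38i reads `rk₂ ≤ 1` as intended once the set is finite. -/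
theorem one_mem_quadraticRayClassCharacters (F : Type) [Field F] [NumberField F] (m : Ideal (𝓞 F)) :
    (fun _ => 1) ∈ quadraticRayClassCharacters F m := by
  refine ⟨?_, ?_, ?_⟩
  · intro I J _ _; simp
  · intro I _; rfl
  · intro a _ _; rfl

/-- JUNK PROBE (A4): at the TRIVIAL modulus `m = ⊤` the typed set collapses to the trivial character (the zero ideal `⊥` is
then «coprime to m», and multiplicativity at `⊥ * J = ⊥` forces `χ J = 1`) — so `Nat.card = 1` there, NOT `2 ^ rk₂ Cl(F)`.
Harmless for the laws: their modulus is `Q ^ 2` with `Q` a prime containing `2`, hence `Q ≠ ⊤` and `Q ^ 2 ≠ ⊤`; recorded so that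
nobody reuses the carrier with `m = ⊤` to mean the class group. -/
theorem quadraticRayClassCharacters_top (F : Type) [Field F] [NumberField F] :
    quadraticRayClassCharacters F ⊤ = {fun _ => 1} := by
  ext χ
  refine ⟨fun h => ?_, fun h => ?_⟩
  · obtain ⟨hmul, -, -⟩ := h
    funext J
    have h1 := hmul ⊥ J (by simp) (by simp)
    rw [Ideal.bot_mul] at h1
    -- h1 : χ ⊥ = χ ⊥ * χ J  in the group ℤˣ
    have : χ J = 1 := by
      have h2 : χ ⊥ * χ J = χ ⊥ * 1 := by rw [mul_one]; exact h1.symm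
      exact mul_left_cancel h2
    simpa using this
  · rw [Set.mem_singleton_iff] at h
    subst h
    exact one_mem_quadraticRayClassCharacters F ⊤

/-- The laws' modulus is never the junk one: a prime `Q` with `2 ∈ Q ^ 2` is a proper ideal, and so is `Q ^ 2`. -/
theorem sq_ne_top_of_isPrime {F : Type} [Field F] [NumberField F] (Q : Ideal (𝓞 F)) (hQ : Q.IsPrime) : Q ^ 2 ≠ ⊤ := by
  intro h
  exact hQ.ne_top (by
    have : Q ^ 2 ≤ Q := Ideal.pow_le_self two_ne_zero
    exact top_le_iff.mp (h ▸ this))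

/-- … and `Q ≠ ⊥` (so the `∀ Q` of the laws never instantiates at the zero ideal, which IS prime in the domain `𝓞 F`). -/
theorem ne_bot_of_two_mem_sq {F : Type} [Field F] [NumberField F] (Q : Ideal (𝓞 F)) (h2 : (2 : 𝓞 F) ∈ Q ^ 2) : Q ≠ ⊥ := by
  rintro rfl
  rw [pow_two, Ideal.bot_mul, Ideal.mem_bot] at h2
  exact two_ne_zero h2

end Certificates

end Summit.BirchSwinnertonDyer.Rank1Residual.F1Sign2.ANg21
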